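import Literature.Topology.FourManifolds.TrisectionFunctorGKCentralSurface
import Literature.Topology.FourManifolds.EmbeddingBoundaryInvariance
import Literature.Topology.FourManifolds.OneHandlebodyBoundaryFundamentalGroup
import Literature.Topology.FourManifolds.CollarTheorem
import Literature.AlgebraicTopology.Homotopy.StrongDeformationRetractCylinder
import Literature.AlgebraicTopology.Homotopy.StrongDeformationRetractTransport
import Literature.AlgebraicTopology.Homotopy.StrongDeformationRetractUnion
import HarnessLib

/-!
# Sectors and handlebodies of a Gay–Kirby trisection: boundaries, collars, connectivity

Topic `Literature/Topology/FourManifolds` (fact seat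
`provefact-Literature.Topology.FourManifolds.isGroupTrisection_groupGKTrisectionOf`: the geometric
bookkeeping behind the van Kampen computations (T2), (T4) of Abrams–Gay–Kirby's fact (a′),
`TrisectionFunctorGKProofs.lean`).  For a Gay–Kirby trisection `S` of `X` (`IsGKTrisection`,
sectors `S l` with corners along the central surface `F = ⋂ l, S l`, handlebodies
`Hᵢ = S (i+1) ∩ S (i+2)`), everything **proved**, no definitions, no named facts:

* `exists_collar_over` — a collar of `∂W` in a compact manifold with boundary `W`, restricted
  over an open subset of `∂W` and pushed forward along an embedding `e : W → X`: an open (in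
  `range e`) set meeting `e(∂W)` exactly in the given open subset and strong deformation
  retracting onto it (collar neighbourhood theorem `BoundaryData.nonempty_collar_of_compactSpace`,
  Hirsch Thm. 4.6.1, and `IsStrongDeformationRetractOf.cylinder_base`);
* `HasHandleDecomposition.isPathConnected_boundary` — the boundary of a compact connected
  manifold all of whose handles have index `< n` is path connected (Kosinski VI (11.5));
* `IsGKTrisection.image_boundary_eq` — **the image of the boundary of a sector is
  `∂X_l = S l ∩ (S (l+1) ∪ S (l+2))`**, by invariance of the boundary
  (`not_mem_nhds_of_isBoundaryPoint`, `EmbeddingBoundaryInvariance.lean`) — the remark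
  "invariance of domain gives `e(∂W) = S j ∪ S l` on the frontier" of `Trisections.lean`;
* path connectivity of the sectors, the handlebodies, the central surface, `∂X_l` and unions of
  sectors; `Fin 3` index identities; `Hᵢ ∩ Hᵢ₊₁ = F`, `Hᵢ ∪ Hᵢ₊₁ = ∂X_{i+2}`;
* `IsGKTrisection.exists_collar_centralSurface` (a collar of `F` inside `Hᵢ`) and
  `IsGKTrisection.exists_collar_sector` (a collar of `S l` over any open subset of `∂X_l`).

## References

* D. Gay, R. Kirby, *Trisecting 4-manifolds*, Geom. Topol. 20 (2016), Def. 1 and Remark 2.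
  [GayKirby2016]
* M. Hirsch, *Differential Topology* (1976), Thm. 4.6.1 (collars). [Hirsch1976]
* A. Kosinski, *Differential Manifolds* (1993), VI (11.5). [Kosinski1993]
* A. Hatcher, *Algebraic Topology* (2002), Thm. 2B.3 (invariance of domain). [HatcherAT2002]
-/

noncomputable section

open Set Function Filter Topology
open scoped Manifold ContDiff

namespace Literature.Topology.FourManifolds

open Literature.AlgebraicTopology Literature.AlgebraicTopology.FundamentalGroup

universe u

/-! ### Collars over open subsets of the boundary, pushed into the ambient space -/

section CollarOver

variable {n : ℕ} {W : Type u} [TopologicalSpace W] [T2Space W] [CompactSpace W]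
  [ChartedSpace (EuclideanHalfSpace (n + 2)) W] [IsManifold (𝓡∂ (n + 2)) ∞ W]
  {X : Type*} [TopologicalSpace X]

/-- **A collar over an open subset of the boundary, seen in the ambient space.**  Let
`e : W → X` be a topological embedding of a compact smooth manifold with boundary (dimension
`≥ 2`) and `N = e(∂W) ∩ O` a relatively open subset of the image of the boundary.  Then there is
a subset `C ⊆ range e`, open in `range e` (`C = range e ∩ O'`), meeting `e(∂W)` exactly in `N`,
which strong deformation retracts onto `N`: the image under `e` of the open collar
`c(Ñ × [0, 1))` over `Ñ = ∂W ∩ e⁻¹(O)` for a collar `c` of `∂W` (collar neighbourhood theorem,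
`BoundaryData.nonempty_collar_of_compactSpace`; Hirsch (1976), Thm. 4.6.1), retracted along the
collar lines (`Homotopy.IsStrongDeformationRetractOf.cylinder_base`). [cite: Hirsch1976, Thm. 4.6.1] -/
theorem exists_collar_over {e : W → X} (he : IsEmbedding e) {N O : Set X} (hO : IsOpen O)
    (hN : N = e '' (𝓡∂ (n + 2)).boundary W ∩ O) :
    ∃ C O' : Set X, IsOpen O' ∧ C = range e ∩ O' ∧ C ∩ e '' (𝓡∂ (n + 2)).boundary W = N ∧
      N ⊆ C ∧ Homotopy.IsStrongDeformationRetractOf N C := by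
  classical
  set b := BoundaryManifold.boundaryData (n + 1) W with hb
  obtain ⟨c⟩ := BoundaryData.nonempty_collar_of_compactSpace n W b
  have hce : IsEmbedding c := c.isSmoothEmbedding.isEmbedding
  -- the open subset `Ñ` of `∂W` over which we take the collar
  set Nt : Set b.carrier := (fun x => e (b.incl x)) ⁻¹' O with hNt
  have hNto : IsOpen Nt := hO.preimage (he.continuous.comp b.continuous_incl)
  -- the restricted collar
  set c' : ↥Nt × Set.Icc (0 : ℝ) 1 → W := fun p => c (p.1.1, p.2) with hc'
  have hc'e : IsEmbedding c' :=
    hce.comp (IsEmbedding.subtypeVal.prodMap IsEmbedding.id)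
  have hsdr := Homotopy.IsStrongDeformationRetractOf.cylinder_base c' hc'e
  have hsdrX := hsdr.image_of_isEmbedding he
  -- the base is `N`
  have hincl : ∀ x : b.carrier, b.incl x = x.1 := fun x => rfl
  have hbase : e '' (c' '' {p | (p.2 : ℝ) = 0}) = N := by
    rw [hN]
    apply Subset.antisymm
    · rintro _ ⟨_, ⟨⟨x, t⟩, ht, rfl⟩, rfl⟩
      have ht0 : t = ⊥ := Subtype.ext ht
      simp only [hc', ht0, c.apply_bot, hincl]
      exact ⟨⟨x.1.1, x.1.2, rfl⟩, x.2⟩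
    · rintro y ⟨⟨w, hw, rfl⟩, hyO⟩
      refine ⟨c' (⟨⟨w, hw⟩, hyO⟩, ⊥), ⟨(⟨⟨w, hw⟩, hyO⟩, ⊥), rfl, rfl⟩, ?_⟩
      simp only [hc', c.apply_bot, hincl]
  -- the open collar over `Ñ` is open in `W`
  have hopenW : IsOpen (c' '' {p | (p.2 : ℝ) < 1}) := by
    set V : Set (b.carrier × Set.Icc (0 : ℝ) 1) := {p | p.1 ∈ Nt ∧ (p.2 : ℝ) < 1} with hV
    have hVo : IsOpen V :=
      (hNto.preimage continuous_fst).inter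
        (isOpen_lt (continuous_subtype_val.comp continuous_snd) continuous_const)
    have himage : c' '' {p | (p.2 : ℝ) < 1} = c '' V := by
      apply Subset.antisymm
      · rintro _ ⟨⟨x, t⟩, ht, rfl⟩
        exact ⟨(x.1, t), ⟨x.2, ht⟩, rfl⟩
      · rintro _ ⟨⟨x, t⟩, ⟨hx, ht⟩, rfl⟩
        exact ⟨(⟨x, hx⟩, t), ht, rfl⟩
    obtain ⟨OW, hOW, hpre⟩ := hce.isInducing.isOpen_iff.1 hVo
    have hVU : V ⊆ {p | (p.2 : ℝ) < 1} := fun p hp => hp.2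
    have hVW : ∀ p, p ∈ V ↔ c p ∈ OW := fun p => by rw [← mem_preimage, hpre]
    have : c '' V = c '' {p | (p.2 : ℝ) < 1} ∩ OW := by
      apply Subset.antisymm
      · rintro _ ⟨p, hp, rfl⟩
        exact ⟨⟨p, hVU hp, rfl⟩, (hVW p).1 hp⟩
      · rintro _ ⟨⟨p, hp, rfl⟩, hy⟩
        exact ⟨p, (hVW p).2 hy, rfl⟩
    rw [himage, this]
    exact c.isOpen_image.inter hOW
  -- its image `C` is open in `range e`
  obtain ⟨O', hO', hpre'⟩ := he.isInducing.isOpen_iff.1 hopenW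
  have hC : e '' (c' '' {p | (p.2 : ℝ) < 1}) = range e ∩ O' := by
    rw [← hpre', image_preimage_eq_range_inter]
  refine ⟨e '' (c' '' {p | (p.2 : ℝ) < 1}), O', hO', hC, ?_, ?_, ?_⟩
  · -- `C ∩ e(∂W) = N`: the collar meets `∂W` only at height `0`
    apply Subset.antisymm
    · rintro y ⟨⟨_, ⟨⟨x, t⟩, ht, rfl⟩, rfl⟩, ⟨w, hw, hwe⟩⟩
      have hweq : w = c' (x, t) := he.injective hwe
      have ht0 : (t : ℝ) = 0 := by
        by_contra hne
        have htpos : ⊥ < t := by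
          rw [bot_lt_iff_ne_bot]
          intro h
          exact hne (by rw [h]; rfl)
        have hint := c.apply_mem_interior x.1 htpos
        rw [← ModelWithCorners.compl_boundary] at hint
        rw [hweq] at hw
        exact hint hw
      rw [← hbase]
      exact ⟨c' (x, t), ⟨(x, t), ht0, rfl⟩, rfl⟩
    · rw [← hbase]
      rintro _ ⟨_, ⟨p, hp, rfl⟩, rfl⟩
      refine ⟨⟨c' p, ⟨p, ?_, rfl⟩, rfl⟩, ?_⟩
      · change (p.2 : ℝ) < 1
        rw [show (p.2 : ℝ) = 0 from hp]
        exact one_pos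
      · have hp0 : p.2 = ⊥ := Subtype.ext hp
        refine ⟨b.incl p.1.1, b.incl_mem_boundary _, ?_⟩
        change e (b.incl p.1.1) = e (c (p.1.1, p.2))
        rw [hp0, c.apply_bot]
  · rw [← hbase]
    exact image_mono (image_mono fun p hp => by
      change (p.2 : ℝ) < 1; rw [show (p.2 : ℝ) = 0 from hp]; exact one_pos)
  · rw [← hbase]
    exact hsdrX

end CollarOver

/-! ### The boundary of a `1`-handlebody is path connected -/

section BoundaryConnected

variable {n : ℕ} {W : Type u} [TopologicalSpace W] [T2Space W] [CompactSpace W] [ConnectedSpace W]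
  [ChartedSpace (EuclideanHalfSpace (n + 1)) W] [IsManifold (𝓡∂ (n + 1)) ∞ W]

/-- **The boundary of a compact connected manifold with handles of index `< n` only is path
connected** (Kosinski, *Differential Manifolds* (1993), VI (11.5): handles of coindex `≥ 2` do
not disconnect the boundary; the tree's `IsMorseAdapted.isPreconnected_boundary_and_nonempty`,
plus local path connectivity of the boundary manifold). [cite: Kosinski1993, VI (11.5)] -/
theorem HasHandleDecomposition.isPathConnected_boundary {c : ℕ → ℕ}
    (h : HasHandleDecomposition n W c) (hc : ∀ j, n ≤ j → c j = 0) (hn : 1 ≤ n) :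
    IsPathConnected ((𝓡∂ (n + 1)).boundary W) := by
  haveI : NeZero n := ⟨by omega⟩
  haveI : LocallyPathConnectedSpace W :=
    ChartedSpace.locallyPathConnectedSpace (EuclideanHalfSpace (n + 1)) W
  obtain ⟨f, hf, hcount⟩ := h
  have hfin : (criticalSet (𝓡∂ (n + 1)) f).Finite := IsMorse.finite_criticalSet_holds hf.isMorse
  have hidx : ∀ x, (𝓡∂ (n + 1)).IsInteriorPoint x → IsMCriticalPt (𝓡∂ (n + 1)) f x →
      morseIndex (𝓡∂ (n + 1)) f x + 2 ≤ n + 1 := by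
    intro x _ hx
    by_contra hlt
    have hle : n ≤ morseIndex (𝓡∂ (n + 1)) f x := by omega
    have hmem : x ∈ criticalSetOfIndex (𝓡∂ (n + 1)) f (morseIndex (𝓡∂ (n + 1)) f x) := ⟨hx, rfl⟩
    have hfin' : (criticalSetOfIndex (𝓡∂ (n + 1)) f (morseIndex (𝓡∂ (n + 1)) f x)).Finite :=
      hfin.subset (criticalSetOfIndex_subset _ f _)
    have h0 : (criticalSetOfIndex (𝓡∂ (n + 1)) f (morseIndex (𝓡∂ (n + 1)) f x)).ncard = 0 := by
      rw [hcount, hc _ hle]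
    rw [(Set.ncard_eq_zero hfin').1 h0] at hmem
    exact hmem
  obtain ⟨hpre, hne⟩ := hf.isPreconnected_boundary_and_nonempty hidx
  haveI : ConnectedSpace ↥((𝓡∂ (n + 1)).boundary W) := isConnected_iff_connectedSpace.1 ⟨hne, hpre⟩
  haveI : LocallyPathConnectedSpace ↥((𝓡∂ (n + 1)).boundary W) :=
    ChartedSpace.locallyPathConnectedSpace (EuclideanSpace ℝ (Fin n)) _
  haveI : PathConnectedSpace ↥((𝓡∂ (n + 1)).boundary W) :=
    pathConnectedSpace_iff_connectedSpace.2 inferInstance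
  exact isPathConnected_iff_pathConnectedSpace.2 this

end BoundaryConnected

/-! ### Sectors and handlebodies of a Gay–Kirby trisection -/

section Trisection

variable {X : Type u} [TopologicalSpace X] [T2Space X] [ChartedSpace (EuclideanSpace ℝ (Fin 4)) X]
  {g : ℕ} {k : Fin 3 → ℕ} {S : Fin 3 → Set X}

/-- Index arithmetic in `Fin 3`: the two other indices. [folklore] -/
theorem fin3_succ_ne (i : Fin 3) : i + 1 ≠ i ∧ i + 2 ≠ i ∧ i + 1 ≠ i + 2 := by
  revert i; decide

/-- Index arithmetic in `Fin 3`. [folklore] -/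
theorem fin3_add (i : Fin 3) : i + 1 + 1 = i + 2 ∧ i + 1 + 2 = i ∧ i + 2 + 1 = i ∧ i + 2 + 2 = i + 1 := by
  revert i; decide

omit [TopologicalSpace X] [T2Space X] [ChartedSpace (EuclideanSpace ℝ (Fin 4)) X] in
/-- `Hᵢ ∩ Hᵢ₊₁ = F`: two of the three handlebodies meet exactly in the central surface.
[cite: GayKirby2016, Def. 1] -/
theorem inter_handlebody_succ (S : Fin 3 → Set X) (i : Fin 3) :
    (S (i + 1) ∩ S (i + 2)) ∩ (S (i + 1 + 1) ∩ S (i + 1 + 2)) = ⋂ l, S l := by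
  obtain ⟨h1, h2, -, -⟩ := fin3_add i
  rw [h1, h2]
  ext x
  simp only [mem_inter_iff, mem_iInter]
  constructor
  · rintro ⟨⟨ha, hb⟩, -, hc⟩ l
    have hcases : ∀ i j : Fin 3, j = i ∨ j = i + 1 ∨ j = i + 2 := by decide
    rcases hcases i l with rfl | rfl | rfl
    exacts [hc, ha, hb]
  · intro hx
    exact ⟨⟨hx _, hx _⟩, hx _, hx _⟩

omit [TopologicalSpace X] [T2Space X] [ChartedSpace (EuclideanSpace ℝ (Fin 4)) X] in
/-- `Hᵢ ∪ Hᵢ₊₁ = X_{i+2} ∩ (Xᵢ ∪ Xᵢ₊₁)`: two of the three handlebodies together form the part of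
the third sector meeting the other two (its boundary, by `IsGKTrisection.image_boundary_eq`).
[cite: GayKirby2016, Def. 1] -/
theorem union_handlebody_succ (S : Fin 3 → Set X) (i : Fin 3) :
    (S (i + 1) ∩ S (i + 2)) ∪ (S (i + 1 + 1) ∩ S (i + 1 + 2)) =
      S (i + 2) ∩ (S (i + 2 + 1) ∪ S (i + 2 + 2)) := by
  obtain ⟨h1, h2, h3, h4⟩ := fin3_add i
  rw [h1, h2, h3, h4]
  ext x
  simp only [mem_inter_iff, mem_union]
  tauto

/-- The sectors of a trisection are closed. [cite: GayKirby2016, Def. 1] -/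
theorem IsGKTrisection.isClosed (h : IsGKTrisection X g k S) (i : Fin 3) : IsClosed (S i) :=
  (h.isCompact i).isClosed

/-- **The image of the boundary of a sector is its intersection with the other two sectors**:
if `e : W → X` presents the sector `S l` (clause (ii) of `IsGKTrisection`), then
`e(∂W) = S l ∩ (S (l+1) ∪ S (l+2))`.  The inclusion `⊇` is part of clause (ii); `⊆` is
invariance of the boundary (`not_mem_nhds_of_isBoundaryPoint`): a boundary point mapped outside
the other two (closed) sectors would have `S l = range e` as a neighbourhood of its image.  This is
the remark "invariance of domain gives `e(∂W) = S j ∪ S l` on the frontier" of the module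
docstring of `Trisections.lean`. [cite: GayKirby2016, Def. 1] -/
theorem IsGKTrisection.image_boundary_eq (h : IsGKTrisection X g k S) {l : Fin 3} {W : Type u}
    [TopologicalSpace W] [ChartedSpace (EuclideanHalfSpace 4) W] {e : W → X} (he : IsEmbedding e)
    (hrange : range e = S l) (hbd : ∀ j, j ≠ l → S l ∩ S j ⊆ e '' (𝓡∂ 4).boundary W) :
    e '' (𝓡∂ 4).boundary W = S l ∩ (S (l + 1) ∪ S (l + 2)) := by
  obtain ⟨hn1, hn2, -⟩ := fin3_succ_ne l
  apply Subset.antisymm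
  · rintro y ⟨w, hw, rfl⟩
    refine ⟨hrange ▸ mem_range_self w, ?_⟩
    by_contra hy
    apply not_mem_nhds_of_isBoundaryPoint (n := 3) he hw
    refine mem_of_superset (((h.isClosed (l + 1)).union (h.isClosed (l + 2))).isOpen_compl.mem_nhds hy)
      fun x hx => ?_
    obtain ⟨i, hi⟩ := h.exists_mem x
    have hcases : ∀ i j : Fin 3, j = i ∨ j = i + 1 ∨ j = i + 2 := by decide
    rcases hcases l i with rfl | rfl | rfl
    · rwa [hrange]
    · exact absurd (Or.inl hi) hx
    · exact absurd (Or.inr hi) hx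
  · rintro y ⟨hyl, hy | hy⟩
    · exact hbd (l + 1) hn1 ⟨hyl, hy⟩
    · exact hbd (l + 2) hn2 ⟨hyl, hy⟩

omit [T2Space X] in
/-- The sectors of a trisection are path connected (images of connected manifolds).
[cite: GayKirby2016, Def. 1] -/
theorem IsGKTrisection.isPathConnected_sector (h : IsGKTrisection X g k S) (l : Fin 3) :
    IsPathConnected (S l) := by
  obtain ⟨W, _, _, e, _, _, hc, -, he, hrange, -⟩ := h.2.1 l
  haveI := hc
  haveI : LocallyPathConnectedSpace W := ChartedSpace.locallyPathConnectedSpace (EuclideanHalfSpace 4) W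
  haveI : PathConnectedSpace W := pathConnectedSpace_iff_connectedSpace.2 hc
  rw [← hrange]
  exact isPathConnected_range he.continuous

omit [T2Space X] in
/-- The handlebodies `Hᵢ = S (i+1) ∩ S (i+2)` of a trisection are path connected (images of
connected manifolds). [cite: GayKirby2016, Def. 1] -/
theorem IsGKTrisection.isPathConnected_handlebody (h : IsGKTrisection X g k S) (i : Fin 3) :
    IsPathConnected (S (i + 1) ∩ S (i + 2)) := by
  obtain ⟨H, _, _, f, _, _, hc, -, hf, hrange, -⟩ := h.2.2 (i + 1) (i + 2) (fin3_succ_ne i).2.2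
  haveI := hc
  haveI : LocallyPathConnectedSpace H := ChartedSpace.locallyPathConnectedSpace (EuclideanHalfSpace 3) H
  haveI : PathConnectedSpace H := pathConnectedSpace_iff_connectedSpace.2 hc
  rw [← hrange]
  exact isPathConnected_range hf.isEmbedding.continuous

/-- The central surface `F = ⋂ l, S l` of a trisection is path connected: it is the image of the
boundary of a genus-`g` handlebody (`HasHandleDecomposition.isPathConnected_boundary`).
[cite: GayKirby2016, Def. 1 and Remark 2 (p. 3098)] -/
theorem IsGKTrisection.isPathConnected_iInter (h : IsGKTrisection X g k S) :
    IsPathConnected (⋂ l, S l) := by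
  obtain ⟨H, _, _, f, hM, hH, hc, hh, hf, -, hbdry⟩ := h.2.2 0 1 (by decide)
  haveI := hM
  haveI := hH
  haveI := hc
  haveI : T2Space H := hf.isEmbedding.t2Space
  rw [← hbdry]
  refine (hh.isPathConnected_boundary (fun j hj => handleCount_of_two_le _ _ hj) one_le_two).image' ?_
  exact hf.isEmbedding.continuous.continuousOn

/-- The part `S l ∩ (S (l+1) ∪ S (l+2))` of a sector meeting the other two (its boundary) is path
connected: it is the union of two handlebodies meeting in the non-empty central surface.
[cite: GayKirby2016, Def. 1] -/
theorem IsGKTrisection.isPathConnected_inter_union (h : IsGKTrisection X g k S) (l : Fin 3) :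
    IsPathConnected (S l ∩ (S (l + 1) ∪ S (l + 2))) := by
  obtain ⟨-, -, h3, h4⟩ := fin3_add l
  have h1 := h.isPathConnected_handlebody (l + 1)
  have h2 := h.isPathConnected_handlebody (l + 2)
  obtain ⟨h11, h12, -, -⟩ := fin3_add l
  rw [h11, h12] at h1
  rw [h3, h4] at h2
  rw [inter_union_distrib_left]
  obtain ⟨x, hx⟩ := h.nonempty_iInter
  have hx' := mem_iInter.1 hx
  refine IsPathConnected.union ?_ ?_ ⟨x, ⟨hx' _, hx' _⟩, hx' _, hx' _⟩
  · rw [inter_comm] at h2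
    convert h2 using 1
    exact inter_comm _ _
  · convert h1 using 1
    ext y; simp only [mem_inter_iff]; tauto

/-- The union of two sectors is path connected (they meet along a handlebody, which contains the
non-empty central surface). [cite: GayKirby2016, Def. 1] -/
theorem IsGKTrisection.isPathConnected_union (h : IsGKTrisection X g k S) (i j : Fin 3) :
    IsPathConnected (S i ∪ S j) := by
  obtain ⟨x, hx⟩ := h.nonempty_iInter
  have hx' := mem_iInter.1 hx
  exact (h.isPathConnected_sector i).union (h.isPathConnected_sector j) ⟨x, hx' i, hx' j⟩

/-- **Collar neighbourhood of the central surface inside a handlebody.**  For each `i` there is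
a subset `K ⊆ Hᵢ = S (i+1) ∩ S (i+2)`, open in `Hᵢ`, containing the central surface
`F = ⋂ l, S l = ∂Hᵢ` and strong deformation retracting onto it (the image of an open collar of
`∂H` in the abstract handlebody `H` of clause (iii)). [cite: GayKirby2016, Def. 1] -/
theorem IsGKTrisection.exists_collar_centralSurface (h : IsGKTrisection X g k S) (i : Fin 3) :
    ∃ K O : Set X, IsOpen O ∧ K = (S (i + 1) ∩ S (i + 2)) ∩ O ∧ (⋂ l, S l) ⊆ K ∧
      Homotopy.IsStrongDeformationRetractOf (⋂ l, S l) K := by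
  obtain ⟨H, _, _, f, hM, hH, _, -, hf, hrange, hbdry⟩ := h.2.2 (i + 1) (i + 2) (fin3_succ_ne i).2.2
  haveI := hM
  haveI := hH
  haveI : T2Space H := hf.isEmbedding.t2Space
  obtain ⟨C, O', hO', hC, -, hNC, hsdr⟩ := exists_collar_over (n := 1) hf.isEmbedding isOpen_univ
    (N := f '' (𝓡∂ 3).boundary H) (by rw [inter_univ])
  refine ⟨C, O', hO', by rw [hC, hrange], ?_, ?_⟩
  · rw [← hbdry]; exact hNC
  · rw [← hbdry]; exact hsdr

/-- **Collar over an open subset of the boundary of a sector.**  For a sector `S l` and a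
subset `N` open in `∂X_l = S l ∩ (S (l+1) ∪ S (l+2))` there is `C ⊆ S l`, open in `S l`,
meeting `∂X_l` exactly in `N`, containing `N` and strong deformation retracting onto it (the
image of the open collar of the abstract sector `W` of clause (ii) over the corresponding open
subset of `∂W`; `∂X_l = e(∂W)` by `IsGKTrisection.image_boundary_eq`). [cite: GayKirby2016, Def. 1] -/
theorem IsGKTrisection.exists_collar_sector (h : IsGKTrisection X g k S) (l : Fin 3) {N O : Set X}
    (hO : IsOpen O) (hN : N = (S l ∩ (S (l + 1) ∪ S (l + 2))) ∩ O) :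
    ∃ C O' : Set X, IsOpen O' ∧ C = S l ∩ O' ∧ C ∩ (S l ∩ (S (l + 1) ∪ S (l + 2))) = N ∧
      N ⊆ C ∧ Homotopy.IsStrongDeformationRetractOf N C := by
  obtain ⟨W, _, _, e, hM, hW, _, -, he, hrange, -, -, hbd⟩ := h.2.1 l
  haveI := hM
  haveI := hW
  haveI : T2Space W := he.t2Space
  have hbdry := h.image_boundary_eq he hrange hbd
  obtain ⟨C, O', hO', hC, hCN, hNC, hsdr⟩ := exists_collar_over (n := 2) he hO (N := N)
    (by rw [hbdry]; exact hN)
  exact ⟨C, O', hO', by rw [hC, hrange], by rw [← hbdry]; exact hCN, hNC, hsdr⟩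

end Trisection

end Literature.Topology.FourManifolds
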